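import Summits.ValiantsHypothesis.ValiantsHypothesis.Theses.BarrierLever
import Summits.ValiantsHypothesis.ValiantsHypothesis.Theorems.BarrierLeverDefinableEquationsVNPVersusVPSPACEEngine
import Summits.ValiantsHypothesis.ValiantsHypothesis.Theorems.BarrierLeverDefinableEquationsVNPVersusVPSPACEDcSlice
import Summits.ValiantsHypothesis.ValiantsHypothesis.Theorems.BarrierLeverDefinableEquationsLevelOne
import Summits.ValiantsHypothesis.ValiantsHypothesis.Theorems.BarrierLeverDefinableDcEquationsBalancedStrength

/-!
# Cruxes `DefinableEquations` (stmt-8745) / `DefinableDcEquations` (stmt-8746) /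
# `SingleSizeEquations` (stmt-8749) of route BarrierLever — REFUTING ANY OF THEM SEPARATES `VNP_ℂ`
# FROM `VPSPACE⁰_b` (Chatterjee–Tengse's "barrier on the barrier", one class up; val-np-p5 g24)

The three `𝒞`-side cruxes of route BarrierLever ask for `VNP(N)`-EXPLICIT equations (nonzero
level-`a` Boolean sums `boolSum H`, `q, L(H), deg H ≤ N^a`, `N = C(2n,n)`) vanishing on the
coefficient vectors of `SmallCircuits ℂ n b` (8745: one `a` for every `b`; 8749: `a` may depend on
`b`; EQUIVALENT in the tree, `definableEquations_iff_singleSizeEquations`) or of the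
super-quasi-polynomial determinantal slice `{deg ≤ n, dc ≤ m(n)}` (8746).  All three are OPEN
(Chatterjee–Tengse, arXiv:2309.07612, §1.3 direction 2: lower the explicitness of SOME equation
for `VP` below `VPSPACE`).  One class higher everything is a THEOREM of the tree:
`CT23_lemma_4_7_holds` (val-lit) gives nonzero multilinear integer equations for the evaluation
vectors of `VP_n(n^b)` with constant-free fan-in-two PROJECTION circuits of size `n^{O(b)}`
(`smallCircuits_evalEquations`), and of the slice of 8746 at `m(n) = 2^((log₂ n + 1)³)` with such
circuits of size `2^(O(log³ n))` (`dcSlice_evalEquations`, sibling file `…VNPVersusVPSPACEDcSlice`).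

THIS FILE applies the route-independent engine (`…VNPVersusVPSPACEEngine`: CT23 Prop. 4.6 for
Boolean sums + the `𝒟 = VNP` separation engine) to the three cruxes:

* §1 `exists_vpspace0b_not_vnp_of_not_singleSizeEquations` (8749),
  `exists_vpspace0b_not_vnp_of_not_definableEquations` (8745, through the dilation equivalence),
  `exists_vpspace0b_not_vnp_of_not_definableDcEquations` (8746, through `dcSlice_evalEquations`
  and `BalancedStrength.threshold_admissible`): **if the crux FAILS, there is an integer family in `VPSPACE⁰_b`
  (`IsVPSPACE0bFamily`: constant-free polynomial-size projection circuits, p-bounded degree)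
  whose image over `ℂ` is NOT in `VNP_ℂ` (`¬ IsVNPFamily`)** — the algebraic half of the LAST
  clause of CT23 Thm. 1.1 ("if `VP` does not admit `VNP`-natural proofs then …", proof §4.3 second
  case, v1 p0019 L6–L8), here for the route's own classes and for ONE failing size exponent `b`
  (the crux's negation is a `VP_n(n^b)`-succinct hitting set against `VNP(N)` infinitely often);
  `exists_vpspace0b_not_vp_of_not_definableEquations`: the same one class lower (`VP ⊆ VNP`).
* §2 `cruxes_of_vpspace0b_subset_vnp` — contrapositive: **the collapse `VPSPACE⁰_b ⊆ VNP_ℂ`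
  implies `DefinableDcEquations ∧ DefinableEquations ∧ SingleSizeEquations`**; route-decl forms
  `singleSizeEquations_of_vpspace0b_subset_vnp`, `definableEquations_of_vpspace0b_subset_vnp`,
  `definableDcEquations_of_vpspace0b_subset_vnp` (CONDITIONAL results: they credit nothing).

READING FOR THE ROUTE.  Crux 2 (`SuccinctHittingSetsForVP`, FSV Question 6) TRUE ⇒
`VPSPACE⁰_b ⊄ VP_ℂ` (CT23 Thm. 4.1; tree, val-lit
`exists_isVPSPACE0bFamily_not_isVPFamily_of_succinctHittingSetsForVP`); crux 3 / crux 4 / support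
8749 FALSE ⇒ `VPSPACE⁰_b ⊄ VNP_ℂ ⊇ VP_ℂ` (this file).  So the route's `𝒞`-side kill criterion
("coefficient vectors of size-`n^b` circuits hit level-`a` Boolean sums, every `a`") is itself a
`VNP ≠ VPSPACE_b`-type theorem — out of reach of present techniques exactly like the Boolean
separations it would entail through the coefficient-function characterisations of `VPSPACE⁰`
and `VNP` (`PSPACE/poly ⊄ CH/poly`-type; that Boolean half is NOT formalised, as in the `VP`
file) — and the cruxes are TRUE in every world where constant-free bounded-degree `VPSPACE`
collapses to `VNP`.  This is a CALIBRATION of refutability, not evidence: the collapse is believed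
false, the cruxes stay OPEN, `VP ≠ VNP` is NOT proved and nothing here bears on it.  No
definitions, no named facts, standard axioms, 0 sorries.

## References

* [ChatterjeeTengse2023] P. Chatterjee, A. Tengse, *Lower Bounds from Succinct Hitting Sets*,
  arXiv:2309.07612: Thm. 1.1 (last clause), §4.3 (v1 p0018 L50–L62, p0019 L1–L8), Prop. 4.6,
  Lemma 4.7, §1.3.
* [ForbesShpilkaVolk2018] M. A. Forbes, A. Shpilka, B. L. Volk, *Succinct hitting sets and
  barriers to proving lower bounds for algebraic circuits*, Theory of Computing 14 (2018), Def. 1,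
  Question 6.
* [Burgisser2000] P. Bürgisser, *Completeness and Reduction in Algebraic Complexity Theory*,
  Def. 2.5 (`IsVNPFamily`).
-/

-- `Summit.ValiantsHypothesis.ValiantsHypothesis.…` repeats a component by the D-0017 layout
-- (single-conjunct summit), which the `dupNamespace` linter flags; the name is mandated.
set_option linter.dupNamespace false

noncomputable section

namespace Summit.ValiantsHypothesis.ValiantsHypothesis.Theorems.BarrierLeverDefinableEquations

open MvPolynomial
open Literature.Computability.AlgebraicComplexity Literature.Barriers.ValiantsHypothesis
open Summit.ValiantsHypothesis.ValiantsHypothesis.Theses.BarrierLever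
open scoped BigOperators

namespace VNPVersusVPSPACE

/-! ## §1 The three cruxes: refuting any of them separates `VNP_ℂ` from `VPSPACE⁰_b` -/

/-- **`¬ SingleSizeEquations ⇒ VPSPACE⁰_b ⊄ VNP_ℂ`** (stmt-ValiantsHypothesis-8749).  If the support
item fails — for some size exponent `b`, for every level `a`, infinitely often in `n`, the
coefficient vectors of `SmallCircuits ℂ n b` (`deg ≤ n`, size `≤ n^b`) hit every nonzero level-`a`
Boolean sum (`boolSum_hitting_io_of_not_singleSizeEquations`): a `VP_n(n^b)`-succinct hitting set
against `VNP(N)` — then Chatterjee–Tengse's projection-circuit equations for `VP_n(n^b)`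
(`smallCircuits_evalEquations`, size `n^c ≤ 2^n` for `n ≥ 4^c`, unconditional since
`CT23_lemma_4_7_holds`) form, through the engine `exists_isVPSPACE0bFamily_not_isVNPFamily`, an
integer family in `VPSPACE⁰_b` (indexed by `N`, `n = ⌊log₄ N⌋`) whose image over `ℂ` is NOT in
`VNP_ℂ`.  Algebraic half of the last clause of CT23 Thm. 1.1; CALIBRATION of what refuting the
item would prove; the item is OPEN; `VP ≠ VNP` is NOT proved.
[cite: ChatterjeeTengse2023, Thm. 1.1 last clause, §4.3 (v1: p0019.txt:L6–L8) and Lemma 4.7] -/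
theorem exists_vpspace0b_not_vnp_of_not_singleSizeEquations (h : ¬ SingleSizeEquations) :
    ∃ P : ∀ N : ℕ, MvPolynomial (degLEMonomials (Nat.log 4 N)) ℤ,
      IsVPSPACE0bFamily P ∧
        ¬ IsVNPFamily (fun N => MvPolynomial.map (Int.castRingHom ℂ) (P N)) := by
  obtain ⟨b, hb⟩ :=
    Summit.ValiantsHypothesis.ValiantsHypothesis.Theorems.SingleSizeEquations.boolSum_hitting_io_of_not_singleSizeEquations h
  obtain ⟨c, n₀, hc⟩ := smallCircuits_evalEquations ℂ b
  refine exists_isVPSPACE0bFamily_not_isVNPFamily ℂ (fun n => SmallCircuits ℂ n b)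
    (fun n f hf => hf.1) (fun n => n₀ ≤ n ∧ 2 ^ (2 * c) ≤ n) (fun n hg => ?_)
    ⟨max n₀ (2 ^ (2 * c)), fun n hn => ⟨le_trans (le_max_left _ _) hn, le_trans (le_max_right _ _) hn⟩⟩
    (fun a n₁ => hb a n₁)
  obtain ⟨t, P, Q, hP0, hPml, hQ2, hQsc, hQc, ht, hQs, hvan⟩ := hc n hg.1
  have hpow : n ^ c ≤ 2 ^ n := pow_le_two_pow_of_le hg.2
  exact ⟨t, P, Q, hP0, hPml, hQ2, hQsc, hQc, ht.trans hpow, hQs.trans hpow, hvan⟩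

/-- **`¬ DefinableEquations ⇒ VPSPACE⁰_b ⊄ VNP_ℂ`** (the rank-3 crux, stmt-ValiantsHypothesis-8745):
through the tree's `SingleSizeEquations → DefinableEquations` (level reduction by dilation,
`definableEquations_of_singleSizeEquations`).  Refuting the crux is (at least) a
`VNP ≠ VPSPACE_b`-type class separation.  Calibration only; the crux is OPEN.
[cite: ChatterjeeTengse2023, Thm. 1.1 last clause, §4.3 (v1: p0019.txt:L6–L8)] -/
theorem exists_vpspace0b_not_vnp_of_not_definableEquations (h : ¬ DefinableEquations) :
    ∃ P : ∀ N : ℕ, MvPolynomial (degLEMonomials (Nat.log 4 N)) ℤ,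
      IsVPSPACE0bFamily P ∧
        ¬ IsVNPFamily (fun N => MvPolynomial.map (Int.castRingHom ℂ) (P N)) :=
  exists_vpspace0b_not_vnp_of_not_singleSizeEquations
    fun hS => h (definableEquations_of_singleSizeEquations hS)

/-- **`¬ DefinableDcEquations ⇒ VPSPACE⁰_b ⊄ VNP_ℂ`** (the rank-4 crux, stmt-ValiantsHypothesis-8746).
If the crux fails then in particular at the admissible threshold `m(n) = 2^((log₂ n + 1)³)`
(`BalancedStrength.threshold_admissible`), for every level `a`, infinitely often in `n`, the degree-`≤ n` polynomials
of determinantal complexity `≤ m(n)` hit every nonzero level-`a` Boolean sum; Chatterjee–Tengse's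
projection-circuit equations for that slice (`dcSlice_evalEquations`, size `2^(O(log³ n)) ≤ 2^n`)
then give, through the engine, an integer `VPSPACE⁰_b` family outside `VNP_ℂ`.  So refuting ANY
of the three open `𝒞`-side cruxes of route BarrierLever (8745, 8746, 8749) requires separating
`VNP_ℂ` from constant-free bounded-degree `VPSPACE`.  Calibration only; the crux is OPEN; nothing
here bears on `VP ≠ VNP`. [cite: ChatterjeeTengse2023, Thm. 1.1 last clause, §4.3 (v1: p0019.txt:L6–L8) and Lemma 4.7] -/
theorem exists_vpspace0b_not_vnp_of_not_definableDcEquations (h : ¬ DefinableDcEquations) :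
    ∃ P : ∀ N : ℕ, MvPolynomial (degLEMonomials (Nat.log 4 N)) ℤ,
      IsVPSPACE0bFamily P ∧
        ¬ IsVNPFamily (fun N => MvPolynomial.map (Int.castRingHom ℂ) (P N)) := by
  -- the negation of the crux at the threshold `m(n) = 2^((log₂ n + 1)^3)`
  have hhit : ∀ a n₀ : ℕ, ∃ n : ℕ, n₀ ≤ n ∧ ∀ q : ℕ, q ≤ ((2 * n).choose n) ^ a →
      ∀ H : MvPolynomial (degLEMonomials n ⊕ Fin q) ℂ,
        complexity H ≤ ((2 * n).choose n) ^ a → H.totalDegree ≤ ((2 * n).choose n) ^ a →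
        boolSum H ≠ 0 →
        ∃ f ∈ {f : MvPolynomial (Fin n) ℂ | f.totalDegree ≤ n ∧
            determinantalComplexity f ≤ 2 ^ ((Nat.log 2 n + 1) ^ 3)},
          eval (coeffVector (degLEMonomials n) f) (boolSum H) ≠ 0 := by
    intro a n₀
    unfold DefinableDcEquations at h
    push Not at h
    obtain ⟨n, hn, hall⟩ :=
      h (fun n => 2 ^ ((Nat.log 2 n + 1) ^ 3)) BalancedStrength.threshold_admissible a n₀
    refine ⟨n, hn, fun q hq H hc hd h0 => ?_⟩
    obtain ⟨f, hfdeg, hfdc, hne⟩ := hall q hq H hc hd h0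
    exact ⟨f, ⟨hfdeg, hfdc⟩, hne⟩
  obtain ⟨c, n₀, hc⟩ := dcSlice_evalEquations
  refine exists_isVPSPACE0bFamily_not_isVNPFamily ℂ
    (fun n => {f : MvPolynomial (Fin n) ℂ | f.totalDegree ≤ n ∧
      determinantalComplexity f ≤ 2 ^ ((Nat.log 2 n + 1) ^ 3)})
    (fun n f hf => hf.1) (fun n => n₀ ≤ n) (fun n hg => ?_) ⟨n₀, fun n hn => hn⟩ hhit
  obtain ⟨t, P, Q, hP0, hPml, hQ2, hQsc, hQc, -, -, ht, hQs, hvan⟩ := hc n hg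
  exact ⟨t, P, Q, hP0, hPml, hQ2, hQsc, hQc, ht, hQs, fun f hf => hvan f hf.1 hf.2⟩

/-- The same one class lower: refuting the rank-3 crux also gives a `VPSPACE⁰_b` family outside
`VP_ℂ` (`VP ⊆ VNP`) — the very conclusion Chatterjee–Tengse draw from the route's OTHER crux
`SuccinctHittingSetsForVP` being TRUE (`exists_isVPSPACE0bFamily_not_isVPFamily_of_succinctHittingSetsForVP`):
crux 2 true or crux 3 false both yield `VP_ℂ ≠ VPSPACE⁰_b`. Calibration only.
[cite: ChatterjeeTengse2023, Thm. 4.1 first clause and Thm. 1.1 last clause] -/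
theorem exists_vpspace0b_not_vp_of_not_definableEquations (h : ¬ DefinableEquations) :
    ∃ P : ∀ N : ℕ, MvPolynomial (degLEMonomials (Nat.log 4 N)) ℤ,
      IsVPSPACE0bFamily P ∧
        ¬ IsVPFamily (fun N => MvPolynomial.map (Int.castRingHom ℂ) (P N)) := by
  obtain ⟨P, hP, hnot⟩ := exists_vpspace0b_not_vnp_of_not_definableEquations h
  exact ⟨P, hP, not_isVPFamily_of_not_isVNPFamily ℂ hnot⟩

/-! ## §2 Contrapositive: the collapse `VPSPACE⁰_b ⊆ VNP_ℂ` proves all three cruxes -/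

/-- **A collapse `VPSPACE⁰_b ⊆ VNP_ℂ` implies the three `𝒞`-side cruxes of route BarrierLever**:
if every integer family with constant-free polynomial-size projection circuits and p-bounded
degree (`IsVPSPACE0bFamily`) becomes a `VNP` family over `ℂ`, then `DefinableDcEquations`
(stmt-8746), `DefinableEquations` (stmt-8745) and `SingleSizeEquations` (stmt-8749) all hold.  In
words: the cruxes ask for `VNP(N)`-explicit equations where `VPSPACE⁰`-explicit ones exist
unconditionally, so they are TRUE in any world where constant-free bounded-degree `VPSPACE`
collapses to `VNP` (e.g. under `CH/poly = PSPACE/poly`; Boolean half not formalised), and refuting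
them is a `VNP ≠ VPSPACE_b`-type theorem.  The hypothesis is believed FALSE; this calibrates the
cruxes' refutability and is NOT evidence for them; `VP ≠ VNP` is NOT proved.
[cite: ChatterjeeTengse2023, Thm. 1.1 last clause and §1.3 (v1: p0019.txt:L6–L8)] -/
theorem cruxes_of_vpspace0b_subset_vnp
    (hsub : ∀ {σ : ℕ → Type} [∀ N, Fintype (σ N)] [∀ N, DecidableEq (σ N)]
      (P : ∀ N, MvPolynomial (σ N) ℤ), IsVPSPACE0bFamily P →
        IsVNPFamily (fun N => MvPolynomial.map (Int.castRingHom ℂ) (P N))) :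
    DefinableDcEquations ∧ DefinableEquations ∧ SingleSizeEquations := by
  refine ⟨?_, ?_, ?_⟩
  · by_contra h
    obtain ⟨P, hP, hnot⟩ := exists_vpspace0b_not_vnp_of_not_definableDcEquations h
    exact hnot (hsub P hP)
  · by_contra h
    obtain ⟨P, hP, hnot⟩ := exists_vpspace0b_not_vnp_of_not_definableEquations h
    exact hnot (hsub P hP)
  · by_contra h
    obtain ⟨P, hP, hnot⟩ := exists_vpspace0b_not_vnp_of_not_singleSizeEquations h
    exact hnot (hsub P hP)

/-- **The support item from the collapse** (verbatim route decl): `(VPSPACE⁰_b ⊆ VNP_ℂ) →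
SingleSizeEquations`. CONDITIONAL on a hypothesis believed false; calibration only.
[cite: ChatterjeeTengse2023, Thm. 1.1 last clause] -/
theorem singleSizeEquations_of_vpspace0b_subset_vnp
    (hsub : ∀ {σ : ℕ → Type} [∀ N, Fintype (σ N)] [∀ N, DecidableEq (σ N)]
      (P : ∀ N, MvPolynomial (σ N) ℤ), IsVPSPACE0bFamily P →
        IsVNPFamily (fun N => MvPolynomial.map (Int.castRingHom ℂ) (P N))) :
    Summit.ValiantsHypothesis.ValiantsHypothesis.Theses.BarrierLever.SingleSizeEquations :=
  (cruxes_of_vpspace0b_subset_vnp hsub).2.2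

/-- **The rank-3 crux from the collapse** (verbatim route decl): `(VPSPACE⁰_b ⊆ VNP_ℂ) →
DefinableEquations`. CONDITIONAL; calibration only. [cite: ChatterjeeTengse2023, Thm. 1.1 last clause] -/
theorem definableEquations_of_vpspace0b_subset_vnp
    (hsub : ∀ {σ : ℕ → Type} [∀ N, Fintype (σ N)] [∀ N, DecidableEq (σ N)]
      (P : ∀ N, MvPolynomial (σ N) ℤ), IsVPSPACE0bFamily P →
        IsVNPFamily (fun N => MvPolynomial.map (Int.castRingHom ℂ) (P N))) :
    Summit.ValiantsHypothesis.ValiantsHypothesis.Theses.BarrierLever.DefinableEquations :=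
  (cruxes_of_vpspace0b_subset_vnp hsub).2.1

/-- **The rank-4 crux from the collapse** (verbatim route decl): `(VPSPACE⁰_b ⊆ VNP_ℂ) →
DefinableDcEquations`. CONDITIONAL; calibration only. [cite: ChatterjeeTengse2023, Thm. 1.1 last clause] -/
theorem definableDcEquations_of_vpspace0b_subset_vnp
    (hsub : ∀ {σ : ℕ → Type} [∀ N, Fintype (σ N)] [∀ N, DecidableEq (σ N)]
      (P : ∀ N, MvPolynomial (σ N) ℤ), IsVPSPACE0bFamily P →
        IsVNPFamily (fun N => MvPolynomial.map (Int.castRingHom ℂ) (P N))) :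
    Summit.ValiantsHypothesis.ValiantsHypothesis.Theses.BarrierLever.DefinableDcEquations :=
  (cruxes_of_vpspace0b_subset_vnp hsub).1

end VNPVersusVPSPACE

end Summit.ValiantsHypothesis.ValiantsHypothesis.Theorems.BarrierLeverDefinableEquations
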